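import Mathlib

/-!
# Stub `stub_reflectionStep` of line `Sketch` (idea `free-tangent-landau-chessboard`)
(crux `Summit.QuantumFields.QCD.Theses.QuarksAsStableAction.WilsonQuarkStability`, item stmt-QuantumFields-9736,
route route-QuantumFields-QuarksAsStableAction)

**The mixed reflection (Cauchy–Schwarz) step on the odd cycle.**  For positive semidefinite letters `T a`,
unitary letters `U b` (with an identity letter `e`, `U e = 1`, and an inversion `ι`, `U (ι b) = (U b)ᴴ`) and words
`c : ZMod (2n+1) → α`, `v : ZMod (2n+1) → β`, write `T_j := T (c j)`, `U_j := U (v j)` and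
`Z := Tr (T_0 U_0 T_1 U_1 ⋯ T_{2n} U_{2n})`.  Factor `T_0 = Rᴴ R`; by cyclicity `Z = Tr (P Q)` with
`P := R U_0 T_1 U_1 ⋯ T_n U_n` and `Q := T_{n+1} U_{n+1} ⋯ T_{2n} U_{2n} Rᴴ`, and the Hilbert–Schmidt
Cauchy–Schwarz inequality gives `‖Z‖² ≤ Re Tr (P Pᴴ) · Re Tr (Qᴴ Q)`.  Using `U_n U_nᴴ = 1`, `T_jᴴ = T_j` and
cyclicity again, `Tr (P Pᴴ)` and `Tr (Qᴴ Q)` are the traces of the two reflected ("doubled") words of length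
`2n+1` appearing in the statement, whence `‖Z‖² ≤ ‖Z⁺‖ · ‖Z⁻‖`.

Organisation: a Hilbert–Schmidt Cauchy–Schwarz lemma, its weighted form `‖Tr (T₀ X Y)‖² ≤
Re Tr (T₀ X Xᴴ) · Re Tr (T₀ Yᴴ Y)` for `T₀ ≥ 0`, two bookkeeping lemmas on `List.range` products of matrices
(regrouping and conjugate-transpose reversal), an abstract version of the step for `ℕ`-indexed letters described
position by position, and finally the `ZMod (2n+1)`-indexed statement by evaluating the letters.

Pure theorem file (Mathlib only, no `def`s).
-/

namespace Summit.QuantumFields.QCD.Cruxes.WilsonQuarkStability.FreeTangentLandauChessboard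

open Matrix
open scoped ComplexOrder MatrixOrder

/-- Cauchy–Schwarz for the Hilbert–Schmidt pairing: `‖Tr (P Q)‖² ≤ Re Tr (P Pᴴ) · Re Tr (Qᴴ Q)`. -/
theorem reflectionStep_norm_sq_trace_mul_le {k : Type} [Fintype k] (P Q : Matrix k k ℂ) :
    ‖(P * Q).trace‖ ^ 2 ≤ (P * Pᴴ).trace.re * (Qᴴ * Q).trace.re := by
  have h1 : ‖(P * Q).trace‖ ≤ ∑ p : k × k, ‖P p.1 p.2‖ * ‖Q p.2 p.1‖ := by
    rw [Fintype.sum_prod_type]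
    simp only [trace, diag_apply, mul_apply]
    exact (norm_sum_le _ _).trans (Finset.sum_le_sum fun i _ =>
      (norm_sum_le _ _).trans (Finset.sum_le_sum fun j _ => (norm_mul _ _).le))
  have h2 : (P * Pᴴ).trace.re = ∑ p : k × k, ‖P p.1 p.2‖ ^ 2 := by
    rw [Fintype.sum_prod_type]
    simp only [trace, diag_apply, mul_apply, conjTranspose_apply, Complex.star_def, Complex.re_sum,
      Complex.mul_conj', ← Complex.ofReal_pow, Complex.ofReal_re]
  have h3 : (Qᴴ * Q).trace.re = ∑ p : k × k, ‖Q p.2 p.1‖ ^ 2 := by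
    rw [Fintype.sum_prod_type]
    simp only [trace, diag_apply, mul_apply, conjTranspose_apply, Complex.star_def, Complex.re_sum,
      Complex.conj_mul', ← Complex.ofReal_pow, Complex.ofReal_re]
  rw [h2, h3]
  calc ‖(P * Q).trace‖ ^ 2 ≤ (∑ p : k × k, ‖P p.1 p.2‖ * ‖Q p.2 p.1‖) ^ 2 :=
        pow_le_pow_left₀ (norm_nonneg _) h1 2
    _ ≤ (∑ p : k × k, ‖P p.1 p.2‖ ^ 2) * ∑ p : k × k, ‖Q p.2 p.1‖ ^ 2 :=
        Finset.sum_mul_sq_le_sq_mul_sq _ _ _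

/-- Weighted Cauchy–Schwarz: for `T₀ ≥ 0`, `‖Tr (T₀ X Y)‖² ≤ Re Tr (T₀ X Xᴴ) · Re Tr (T₀ Yᴴ Y)`
(factor `T₀ = Rᴴ R` and apply `reflectionStep_norm_sq_trace_mul_le` to `P = R X`, `Q = Y Rᴴ`). -/
theorem reflectionStep_norm_sq_trace_psd_mul_le {k : Type} [Fintype k] [DecidableEq k]
    {T₀ : Matrix k k ℂ} (hT₀ : T₀.PosSemidef) (X Y : Matrix k k ℂ) :
    ‖(T₀ * X * Y).trace‖ ^ 2 ≤ (T₀ * (X * Xᴴ)).trace.re * (T₀ * (Yᴴ * Y)).trace.re := by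
  obtain ⟨R, hR⟩ := CStarAlgebra.nonneg_iff_eq_star_mul_self.mp hT₀.nonneg
  rw [hR, star_eq_conjTranspose]
  have e1 : (Rᴴ * R * X * Y).trace = (R * X * (Y * Rᴴ)).trace := by
    rw [Matrix.mul_assoc, Matrix.mul_assoc, trace_mul_comm]
    simp only [Matrix.mul_assoc]
  have e2 : (R * X * (R * X)ᴴ).trace = (Rᴴ * R * (X * Xᴴ)).trace := by
    rw [conjTranspose_mul, show R * X * (Xᴴ * Rᴴ) = R * (X * Xᴴ) * Rᴴ by simp only [Matrix.mul_assoc],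
      trace_mul_comm]
    simp only [Matrix.mul_assoc]
  have e3 : ((Y * Rᴴ)ᴴ * (Y * Rᴴ)).trace = (Rᴴ * R * (Yᴴ * Y)).trace := by
    rw [conjTranspose_mul, conjTranspose_conjTranspose,
      show R * Yᴴ * (Y * Rᴴ) = R * (Yᴴ * Y) * Rᴴ by simp only [Matrix.mul_assoc], trace_mul_comm]
    simp only [Matrix.mul_assoc]
  rw [e1, ← e2, ← e3]
  exact reflectionStep_norm_sq_trace_mul_le (R * X) (Y * Rᴴ)

/-- Regrouping an alternating word: `∏_{i<m+1} (p i * q i) = p 0 * (∏_{i<m} q i * p (i+1)) * q m`. -/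
theorem reflectionStep_prod_range_succ_regroup {k : Type} [Fintype k] [DecidableEq k]
    (p q : ℕ → Matrix k k ℂ) (m : ℕ) :
    ((List.range (m + 1)).map fun i => p i * q i).prod =
      p 0 * ((List.range m).map fun i => q i * p (i + 1)).prod * q m := by
  induction m with
  | zero => simp [List.range_succ]
  | succ m ih =>
    rw [List.prod_range_succ, ih, List.prod_range_succ]
    simp only [Matrix.mul_assoc]

/-- Conjugate transpose of a `List.range` product: `(∏_{i<m} g i)ᴴ = ∏_{t<m} (g (m-1-t))ᴴ`. -/
theorem reflectionStep_conjTranspose_prod_range_map {k : Type} [Fintype k] [DecidableEq k]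
    (g : ℕ → Matrix k k ℂ) (m : ℕ) :
    (((List.range m).map g).prod)ᴴ = ((List.range m).map fun t => (g (m - 1 - t))ᴴ).prod := by
  induction m with
  | zero => simp
  | succ m ih =>
    rw [List.prod_range_succ, conjTranspose_mul, ih, List.prod_range_succ']
    have e0 : m + 1 - 1 - 0 = m := by omega
    rw [e0]
    congr 1
    refine congrArg List.prod (List.map_congr_left fun t _ => ?_)
    have e1 : m + 1 - 1 - (t + 1) = m - 1 - t := by omega
    rw [e1]

/-- **Abstract reflection step** for `ℕ`-indexed letters.  `a, b` are the positive and unitary letters of the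
word, `ap, bp` (resp. `am, bm`) those of the first (resp. second) reflected word, described position by position
on `{0, …, 2n}`; only `(a 0).PosSemidef`, Hermiticity of the `a i` and `b n * (b n)ᴴ = 1` are used. -/
theorem reflectionStep_abstract {k : Type} [Fintype k] [DecidableEq k] (n : ℕ)
    (a b ap bp am bm : ℕ → Matrix k k ℂ)
    (ha0 : (a 0).PosSemidef) (ha : ∀ i, (a i)ᴴ = a i) (hb : b n * (b n)ᴴ = 1)
    (hap1 : ∀ i ≤ n, ap i = a i) (hap2 : ∀ t < n, ap (n + 1 + t) = a (n - t))
    (hbp1 : ∀ i < n, bp i = b i) (hbp2 : bp n = 1) (hbp3 : ∀ t < n, bp (n + 1 + t) = (b (n - 1 - t))ᴴ)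
    (ham1 : am 0 = a 0) (ham2 : ∀ i < n, am (i + 1) = a (2 * n - i))
    (ham3 : ∀ t < n, am (n + 1 + t) = a (n + 1 + t))
    (hbm1 : ∀ i < n, bm i = (b (2 * n - i))ᴴ) (hbm2 : bm n = 1)
    (hbm3 : ∀ t < n, bm (n + 1 + t) = b (n + 1 + t)) :
    ‖((List.range (2 * n + 1)).map fun i => a i * b i).prod.trace‖ ^ 2 ≤
      ‖((List.range (2 * n + 1)).map fun i => ap i * bp i).prod.trace‖ *
        ‖((List.range (2 * n + 1)).map fun i => am i * bm i).prod.trace‖ := by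
  obtain ⟨V, hV⟩ : ∃ V : Matrix k k ℂ, ((List.range n).map fun i => b i * a (i + 1)).prod = V :=
    ⟨_, rfl⟩
  obtain ⟨Y, hY⟩ :
      ∃ Y : Matrix k k ℂ, ((List.range n).map fun t => a (n + 1 + t) * b (n + 1 + t)).prod = Y :=
    ⟨_, rfl⟩
  have hsplit : ∀ f : ℕ → Matrix k k ℂ, ((List.range (2 * n + 1)).map f).prod =
      ((List.range (n + 1)).map f).prod * ((List.range n).map fun t => f (n + 1 + t)).prod := by
    intro f
    rw [show 2 * n + 1 = (n + 1) + n by ring, List.range_add, List.map_append, List.prod_append,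
      List.map_map]
    rfl
  -- the word itself: `a 0 * (V * b n) * Y`
  have hw : ((List.range (2 * n + 1)).map fun i => a i * b i).prod = a 0 * (V * b n) * Y := by
    rw [hsplit, reflectionStep_prod_range_succ_regroup, hV, hY]
    simp only [Matrix.mul_assoc]
  -- the first reflected word: `a 0 * ((V * b n) * (V * b n)ᴴ)`
  have hwp : ((List.range (2 * n + 1)).map fun i => ap i * bp i).prod = a 0 * ((V * b n) * (V * b n)ᴴ) := by
    rw [hsplit, reflectionStep_prod_range_succ_regroup, hbp2, hap1 0 (Nat.zero_le _), Matrix.mul_one]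
    have e1 : ((List.range n).map fun i => bp i * ap (i + 1)) =
        (List.range n).map fun i => b i * a (i + 1) := by
      refine List.map_congr_left fun i hi => ?_
      rw [List.mem_range] at hi
      rw [hbp1 i hi, hap1 (i + 1) hi]
    have e2 : ((List.range n).map fun t => ap (n + 1 + t) * bp (n + 1 + t)) =
        (List.range n).map fun t => a (n - t) * (b (n - 1 - t))ᴴ := by
      refine List.map_congr_left fun t ht => ?_
      rw [List.mem_range] at ht
      rw [hap2 t ht, hbp3 t ht]
    have e3 : (V * b n) * (V * b n)ᴴ = V * Vᴴ := by
      rw [conjTranspose_mul, Matrix.mul_assoc, ← Matrix.mul_assoc (b n), hb, Matrix.one_mul]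
    have e4 : Vᴴ = ((List.range n).map fun t => a (n - t) * (b (n - 1 - t))ᴴ).prod := by
      rw [← hV, reflectionStep_conjTranspose_prod_range_map]
      refine congrArg List.prod (List.map_congr_left fun t ht => ?_)
      rw [List.mem_range] at ht
      rw [conjTranspose_mul, ha, show n - 1 - t + 1 = n - t by omega]
    rw [e1, hV, e2, e3, e4, Matrix.mul_assoc]
  -- the second reflected word: `a 0 * (Yᴴ * Y)`
  have hwm : ((List.range (2 * n + 1)).map fun i => am i * bm i).prod = a 0 * (Yᴴ * Y) := by
    rw [hsplit, reflectionStep_prod_range_succ_regroup, hbm2, ham1, Matrix.mul_one]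
    have e1 : ((List.range n).map fun i => bm i * am (i + 1)) =
        (List.range n).map fun t => (b (2 * n - t))ᴴ * a (2 * n - t) := by
      refine List.map_congr_left fun i hi => ?_
      rw [List.mem_range] at hi
      rw [hbm1 i hi, ham2 i hi]
    have e2 : ((List.range n).map fun t => am (n + 1 + t) * bm (n + 1 + t)) =
        (List.range n).map fun t => a (n + 1 + t) * b (n + 1 + t) := by
      refine List.map_congr_left fun t ht => ?_
      rw [List.mem_range] at ht
      rw [ham3 t ht, hbm3 t ht]
    have e4 : Yᴴ = ((List.range n).map fun t => (b (2 * n - t))ᴴ * a (2 * n - t)).prod := by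
      rw [← hY, reflectionStep_conjTranspose_prod_range_map]
      refine congrArg List.prod (List.map_congr_left fun t ht => ?_)
      rw [List.mem_range] at ht
      rw [conjTranspose_mul, ha, show n + 1 + (n - 1 - t) = 2 * n - t by omega]
    rw [e1, e2, hY, e4, Matrix.mul_assoc]
  rw [hw, hwp, hwm]
  calc ‖(a 0 * (V * b n) * Y).trace‖ ^ 2
      ≤ (a 0 * ((V * b n) * (V * b n)ᴴ)).trace.re * (a 0 * (Yᴴ * Y)).trace.re :=
        reflectionStep_norm_sq_trace_psd_mul_le ha0 _ _
    _ ≤ |(a 0 * ((V * b n) * (V * b n)ᴴ)).trace.re| * |(a 0 * (Yᴴ * Y)).trace.re| := by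
        rw [← abs_mul]
        exact le_abs_self _
    _ ≤ _ := mul_le_mul (Complex.abs_re_le_norm _) (Complex.abs_re_le_norm _) (abs_nonneg _)
        (norm_nonneg _)

/-- **Stub `stub_reflectionStep`** (line `Sketch`, crux `WilsonQuarkStability`): the mixed reflection step on the
odd cycle, `‖Z(c,v)‖² ≤ ‖Z(c⁺,v⁺)‖ · ‖Z(c⁻,v⁻)‖` (see the module docstring). -/
theorem stub_reflectionStep {k α β : Type} [Fintype k] [DecidableEq k] (n : ℕ)
    (T : α → Matrix k k ℂ) (hT : ∀ a, (T a).PosSemidef)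
    (U : β → Matrix k k ℂ) (hU : ∀ b, U b ∈ Matrix.unitaryGroup k ℂ)
    (e : β) (he : U e = 1) (ι : β → β) (hι : ∀ b, U (ι b) = (U b)ᴴ)
    (c : ZMod (2 * n + 1) → α) (v : ZMod (2 * n + 1) → β) :
    ‖((List.range (2 * n + 1)).map fun i : ℕ =>
          T (c (i : ZMod (2 * n + 1))) * U (v (i : ZMod (2 * n + 1)))).prod.trace‖ ^ 2 ≤
      ‖((List.range (2 * n + 1)).map fun i : ℕ =>
          T ((fun j : ZMod (2 * n + 1) => if j.val ≤ n then c j else c (-j)) (i : ZMod (2 * n + 1))) *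
            U ((fun j : ZMod (2 * n + 1) =>
              if j.val < n then v j else if j.val = n then e else ι (v (-1 - j))) (i : ZMod (2 * n + 1)))).prod.trace‖ *
      ‖((List.range (2 * n + 1)).map fun i : ℕ =>
          T ((fun j : ZMod (2 * n + 1) => if 0 < j.val ∧ j.val ≤ n then c (-j) else c j) (i : ZMod (2 * n + 1))) *
            U ((fun j : ZMod (2 * n + 1) =>
              if j.val < n then ι (v (-1 - j)) else if j.val = n then e else v j) (i : ZMod (2 * n + 1)))).prod.trace‖ := by
  have hval : ∀ i : ℕ, i < 2 * n + 1 → ((i : ℕ) : ZMod (2 * n + 1)).val = i := fun i hi => by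
    rw [ZMod.val_natCast, Nat.mod_eq_of_lt hi]
  have hneg : ∀ i j : ℕ, i + j = 2 * n + 1 →
      -((i : ℕ) : ZMod (2 * n + 1)) = ((j : ℕ) : ZMod (2 * n + 1)) := by
    intro i j h
    have h2 : ((i : ℕ) : ZMod (2 * n + 1)) + ((j : ℕ) : ZMod (2 * n + 1)) = 0 := by
      rw [← Nat.cast_add, h, ZMod.natCast_self]
    linear_combination -h2
  have hneg1 : ∀ i j : ℕ, i + j + 1 = 2 * n + 1 →
      -1 - ((i : ℕ) : ZMod (2 * n + 1)) = ((j : ℕ) : ZMod (2 * n + 1)) := by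
    intro i j h
    have h2 : ((i : ℕ) : ZMod (2 * n + 1)) + ((j : ℕ) : ZMod (2 * n + 1)) + 1 = 0 := by
      rw [← Nat.cast_add, ← Nat.cast_add_one, h, ZMod.natCast_self]
    linear_combination -h2
  dsimp only
  refine reflectionStep_abstract n (fun i : ℕ => T (c i)) (fun i : ℕ => U (v i)) _ _ _ _ (hT _)
    (fun i => (hT _).isHermitian) (Matrix.mem_unitaryGroup_iff.mp (hU _))
    ?_ ?_ ?_ ?_ ?_ ?_ ?_ ?_ ?_ ?_ ?_
  · intro i hi
    rw [hval i (by omega), if_pos hi]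
  · intro t ht
    rw [hval (n + 1 + t) (by omega), if_neg (by omega), hneg (n + 1 + t) (n - t) (by omega)]
  · intro i hi
    rw [hval i (by omega), if_pos hi]
  · rw [hval n (by omega), if_neg (lt_irrefl n), if_pos rfl, he]
  · intro t ht
    rw [hval (n + 1 + t) (by omega), if_neg (by omega), if_neg (by omega), hι,
      hneg1 (n + 1 + t) (n - 1 - t) (by omega)]
  · rw [hval 0 (by omega), if_neg (by omega)]
  · intro i hi
    rw [hval (i + 1) (by omega), if_pos (by omega), hneg (i + 1) (2 * n - i) (by omega)]
  · intro t ht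
    rw [hval (n + 1 + t) (by omega), if_neg (by omega)]
  · intro i hi
    rw [hval i (by omega), if_pos hi, hι, hneg1 i (2 * n - i) (by omega)]
  · rw [hval n (by omega), if_neg (lt_irrefl n), if_pos rfl, he]
  · intro t ht
    rw [hval (n + 1 + t) (by omega), if_neg (by omega), if_neg (by omega)]

end Summit.QuantumFields.QCD.Cruxes.WilsonQuarkStability.FreeTangentLandauChessboard
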